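import Summits.QuantumFields.BalabanUV.Beta.D1BFx.GramWeightDeterminant

/-!
# `BalabanUV.Beta.D1BFx.SliceTransferDefect` — road «BF-x» for binder row D1, slot (K), row **(K8-L) «NON-LOCAL REDUCTION»**, PART 1 (determinant level):
# THE SLICE-TRANSFER IDENTITY WITHOUT WARD LETTERS — for ANY symmetric form `Y`, ANY gauge-mode matrix `W` killed by the constraints (`Q·W = 0`) with
# `Φ := WᵀYW` and the comb Gram `τW` invertible, the weighted∕constrained and the sharp-gauge∕constrained bordered determinants are related EXACTLY by
#   `det kkt Y Q · det(τW)² = (−1)^{|ρ|} · det Φ · det kkt (Y − Y·W·Φ⁻¹·Wᵀ·Y) [Q; τ]`,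
# i.e. the sharp slice sees the DEFLATED form `Y − YWΦ⁻¹WᵀY`, which kills `W` two-sidedly BY CONSTRUCTION; writing `Y = K + B` the deflated form is
# `K + D` with the DEFECT `D := B − YWΦ⁻¹WᵀY`, and `D = 0` exactly when the order-0 Ward relation `K·W = 0` holds and `B` is a rank-`|ρ|` weight —
# then the statement IS gan24-leaf-03-g44's `GramWeightDeterminant.det_kkt_add_rankWeight` (K-TA4G PART 1), of which this file is the letter-free form
# (owner FINDING F-g8-2, `HOME/b2b-balaban-beta-d1-p2/SLICE-TRANSFER-DEFECT.md`; numerically certified on random data, kit j119050 ∕ j119260)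

HONEST DEPENDENCY (cell records, verbatim): «continuum YM on T⁴ ⇐ BetaPertH ∧ nine spine estimates (0/9 proved); BetaPertH ⇐ (D1) ∧ (D4) ∧
CAP+tail; G-an2-4 gates asym, D1 and NE2/3/4.»  HONEST FRAMING (cell contract, verbatim): «discharging `BetaPertH` makes Bałaban's UV stability
UNCONDITIONAL — a real constructive-QFT result; it is NOT the continuum limit and NOT the Clay problem.»  THIS MODULE DISCHARGES NOTHING of (K),
of D1 or of the wall: [folklore] finite-dimensional linear algebra over the tree's `GramWeightDeterminant.det_kkt_add_weight_slice` (itself over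
`Beta.GaugeFixing`) and Mathlib's `Matrix` API.  ONE definition with a body ([our object] `defect`, a NAME for `B − YWΦ⁻¹WᵀY`; asserts nothing),
no `def … : Prop`, nothing cited, no wall binder instantiated, 0 sorry.  NOT D1, NOT BetaPertH, NOT continuum, NOT Clay.

ABSOLUTE RULE (cell charter, verbatim): «No internally-minted statement may enter as a cited fact. Every hypothesis is either kernel-proved in this
package or a verbatim quotation of a PUBLISHED theorem with page reference. The manuscript(s) under audit are NOT citable for their own disputed
steps — they are the thing under adjudication; programme-internal (2001/route/tribunal) claims are never citable.»

WHY (owner FINDING F-g8-2 ∕ row (K8-L), journal 2026-08-21).  K-TA4G (`det_kkt_add_rankWeight`, `hessT_gramTransfer_jets`) transfers the one-shot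
functional from the sharp comb slice to the R-weighted bordered system UNDER the contentful Ward letters `K·W = 0`, `Kᵀ·W = 0` (+ their jets).
When the letters fail (an1-g33 WARD2∕WARD3: raw fine-bond letters fail on comb bonds), the located difference X₄ (F-g7-1) was unpriced.  This file
prices it at the determinant level with NO letter at all: the sharp-slice determinant of `K + D` (not of `K`) is what the weighted system computes,
`D` explicit; PART 2 (jets ∕ `hessT` form: `Δ_{R1} = −[hessT(G_S;(K+D)•) − hessT(G_S;K•)]`, first jet `D_s = −(E_s𝒫₀ᵀ + 𝒫₀E_sᵀ) + 𝒫₀(W₀ᵀK_sW₀)𝒫₀ᵀ`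
with the Ward failure `E_s = (KW)_s` and `𝒫₀ = B₀W₀Φ₀⁻¹`) follows the `SliceTransferJets` pattern and is NOT in this file.
CONTENT (field `𝕜`; `ν`, `μ`, `ρ` finite; `Y K B : ν×ν`, `Q : μ×ν`, `τ : ρ×ν`, `W : ν×ρ`):
* §1 [folklore] the deflated form `Y − Y·W·(WᵀYW)⁻¹·Wᵀ·Y` kills `W` on the right (`deflate_mul_basis`), is symmetric for symmetric `Y`
  (`deflate_transpose`), hence kills `W` on the left; and `Y` = deflated form + the co-frame weight `(WᵀY)ᵀ·Φ⁻¹·(WᵀY)` (`deflate_add_coframe`).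
* §2 [folklore] **`det_kkt_transfer_deflate`**: `Yᵀ = Y`, `Q·W = 0`, `det(WᵀYW)`, `det(τW)` invertible ⟹
  `det kkt Y Q · det(τW)² = (−1)^{|ρ|} · det(WᵀYW) · det kkt (Y − YW(WᵀYW)⁻¹WᵀY) [Q; τ]` — `det_kkt_add_weight_slice` at `K :=` the deflated form,
  `τ′ := WᵀY`, `A := Φ⁻¹`.
* §3 [our object] `defect K B W := B − (K+B)·W·(Wᵀ(K+B)W)⁻¹·Wᵀ·(K+B)`; [folklore] `add_defect_eq_deflate` (`K + defect = deflated (K+B)`),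
  **`det_kkt_transfer_defect`** (§2 in the road's letters: `det kkt (K+B) Q · det(τW)² = (−1)^{|ρ|}·det Φ·det kkt (K + defect K B W) [Q; τ]`),
  **`defect_eq_zero`** (`K·W = 0`, `Kᵀ = K`, `Bᵀ = B`, rank identity `B·W·(WᵀBW)⁻¹·Wᵀ·B = B` ⟹ `defect K B W = 0` and `Wᵀ(K+B)W = WᵀBW`).
* §4 [folklore] over `ℝ`: `log_absDet_transfer_defect` — `log|det kkt (K+B) Q| + 2·log|det(τW)| = log|det Φ| + log|det kkt (K + D) [Q; τ]|`.
Unit `b2b-balaban-beta-d1-p2` (road owner, gen 8); `K-END-RECUT-SPEC.md` row (K8-L); `SLICE-TRANSFER-DEFECT.md` §1.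
-/

namespace Summit.QuantumFields.BalabanUV.Beta.D1BFx.SliceTransferDefect

open Matrix
open Literature.MathematicalPhysics.QuantumFieldTheory.Balaban1983to89.Beta.Composition (kkt)
open Summit.QuantumFields.BalabanUV.Beta.D1BFx.GramWeightDeterminant (det_kkt_add_weight_slice gram_transpose log_form_of_abs_identity
  abs_form_of_det_identity)

/-! ## §1 The deflated form -/

section Field

variable {𝕜 : Type*} [Field 𝕜]
variable {ν μ ρ : Type*} [Fintype ν] [Fintype μ] [Fintype ρ] [DecidableEq ν] [DecidableEq μ] [DecidableEq ρ]

omit [Fintype μ] [DecidableEq ν] [DecidableEq μ] in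
/-- [folklore] **THE DEFLATED FORM KILLS THE GAUGE MODES ON THE RIGHT**: `(Y − Y·W·(WᵀYW)⁻¹·Wᵀ·Y)·W = 0` whenever `det(WᵀYW)` is a unit. -/
theorem deflate_mul_basis (Y : Matrix ν ν 𝕜) (W : Matrix ν ρ 𝕜) (hΦ : IsUnit (Wᵀ * Y * W).det) :
    (Y - Y * W * (Wᵀ * Y * W)⁻¹ * Wᵀ * Y) * W = 0 := by
  rw [Matrix.sub_mul]
  have e : Y * W * (Wᵀ * Y * W)⁻¹ * Wᵀ * Y * W = Y * W * ((Wᵀ * Y * W)⁻¹ * (Wᵀ * Y * W)) := by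
    simp only [Matrix.mul_assoc]
  rw [e, nonsing_inv_mul _ hΦ, Matrix.mul_one, sub_self]

omit [Fintype μ] [DecidableEq ν] [DecidableEq μ] in
/-- [folklore] For a symmetric form the deflated form is symmetric. -/
theorem deflate_transpose {Y : Matrix ν ν 𝕜} (hY : Yᵀ = Y) (W : Matrix ν ρ 𝕜) :
    (Y - Y * W * (Wᵀ * Y * W)⁻¹ * Wᵀ * Y)ᵀ = Y - Y * W * (Wᵀ * Y * W)⁻¹ * Wᵀ * Y := by
  have hΦt : (Wᵀ * Y * W)ᵀ = Wᵀ * Y * W := gram_transpose hY W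
  have hΦit : ((Wᵀ * Y * W)⁻¹)ᵀ = (Wᵀ * Y * W)⁻¹ := by rw [transpose_nonsing_inv, hΦt]
  have e : (Y * W * (Wᵀ * Y * W)⁻¹ * Wᵀ * Y)ᵀ = Y * W * (Wᵀ * Y * W)⁻¹ * Wᵀ * Y := by
    rw [Matrix.transpose_mul, Matrix.transpose_mul, Matrix.transpose_mul, Matrix.transpose_mul, Matrix.transpose_transpose, hY,
      hΦit]
    simp only [Matrix.mul_assoc]
  rw [Matrix.transpose_sub, hY, e]

omit [Fintype μ] [DecidableEq ν] [DecidableEq μ] in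
/-- [folklore] … hence it kills the gauge modes on the left as well: `(deflated)ᵀ·W = 0`. -/
theorem deflate_transpose_mul_basis {Y : Matrix ν ν 𝕜} (hY : Yᵀ = Y) (W : Matrix ν ρ 𝕜) (hΦ : IsUnit (Wᵀ * Y * W).det) :
    (Y - Y * W * (Wᵀ * Y * W)⁻¹ * Wᵀ * Y)ᵀ * W = 0 := by
  rw [deflate_transpose hY W, deflate_mul_basis Y W hΦ]

omit [Fintype μ] [DecidableEq ν] [DecidableEq μ] in
/-- [folklore] **`Y` = DEFLATED FORM + THE CO-FRAME WEIGHT `(WᵀY)ᵀ·Φ⁻¹·(WᵀY)`** (symmetric `Y`). -/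
theorem deflate_add_coframe {Y : Matrix ν ν 𝕜} (hY : Yᵀ = Y) (W : Matrix ν ρ 𝕜) :
    (Y - Y * W * (Wᵀ * Y * W)⁻¹ * Wᵀ * Y) + (Wᵀ * Y)ᵀ * (Wᵀ * Y * W)⁻¹ * (Wᵀ * Y) = Y := by
  have e : (Wᵀ * Y)ᵀ * (Wᵀ * Y * W)⁻¹ * (Wᵀ * Y) = Y * W * (Wᵀ * Y * W)⁻¹ * Wᵀ * Y := by
    rw [Matrix.transpose_mul, Matrix.transpose_transpose, hY]
    simp only [Matrix.mul_assoc]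
  rw [e, sub_add_cancel]

/-! ## §2 The letter-free slice transfer at the determinant level -/

/-- [folklore] **THE SLICE-TRANSFER IDENTITY WITHOUT WARD LETTERS**: for a symmetric form `Y`, constraints `Q` with `Q·W = 0`, comb rows `τ`
with `det(τW)` a unit and `Φ := WᵀYW` with `det Φ` a unit,
`det kkt Y Q · det(τW)² = (−1)^{|ρ|} · det Φ · det kkt (Y − Y·W·Φ⁻¹·Wᵀ·Y) [Q; τ]`.
(`GramWeightDeterminant.det_kkt_add_weight_slice` at `K :=` the deflated form — which satisfies both order-0 Ward relations BY CONSTRUCTION —,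
co-frame `τ′ := WᵀY`, weight `A := Φ⁻¹`; then `det Φ⁻¹ · det(τ′W)² = det Φ⁻¹ · det Φ² = det Φ`.) -/
theorem det_kkt_transfer_deflate {Y : Matrix ν ν 𝕜} (hY : Yᵀ = Y) (Q : Matrix μ ν 𝕜) (τ : Matrix ρ ν 𝕜) (W : Matrix ν ρ 𝕜)
    (hQW : Q * W = 0) (hΦ : IsUnit (Wᵀ * Y * W).det) (hT : IsUnit (τ * W).det) :
    (kkt Y Q).det * (τ * W).det ^ 2
      = (-1) ^ Fintype.card ρ * (Wᵀ * Y * W).det * (kkt (Y - Y * W * (Wᵀ * Y * W)⁻¹ * Wᵀ * Y) (fromRows Q τ)).det := by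
  set Y' : Matrix ν ν 𝕜 := Y - Y * W * (Wᵀ * Y * W)⁻¹ * Wᵀ * Y with hY'
  have h1 : Y' * W = 0 := deflate_mul_basis Y W hΦ
  have h2 : Y'ᵀ * W = 0 := deflate_transpose_mul_basis hY W hΦ
  have hT' : IsUnit (Wᵀ * Y * W).det := hΦ
  have hA : IsUnit ((Wᵀ * Y * W)⁻¹).det := Matrix.isUnit_nonsing_inv_det _ hΦ
  have h := det_kkt_add_weight_slice Y' Q τ (Wᵀ * Y) W (Wᵀ * Y * W)⁻¹ h1 h2 hQW hT hT' hA
  rw [hY', deflate_add_coframe hY W] at h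
  rw [h]
  have hu : ((Wᵀ * Y * W)⁻¹).det * (Wᵀ * Y * W).det = 1 := Matrix.det_nonsing_inv_mul_det _ hΦ
  linear_combination ((-1 : 𝕜) ^ Fintype.card ρ * (Wᵀ * Y * W).det *
    (kkt (Y - Y * W * (Wᵀ * Y * W)⁻¹ * Wᵀ * Y) (fromRows Q τ)).det) * hu

/-! ## §3 The defect -/

/-- [our object] **THE SLICE-TRANSFER DEFECT** of a form `K` and a weight `B` against the gauge modes `W`:
`defect K B W := B − (K+B)·W·(Wᵀ(K+B)W)⁻¹·Wᵀ·(K+B)`.  A definition (a name); asserts nothing.  `K + defect K B W` is the deflated form of `K + B`;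
it vanishes under the order-0 Ward relation and the rank identity (`defect_eq_zero`). -/
noncomputable def defect (K B : Matrix ν ν 𝕜) (W : Matrix ν ρ 𝕜) : Matrix ν ν 𝕜 :=
  B - (K + B) * W * (Wᵀ * (K + B) * W)⁻¹ * Wᵀ * (K + B)

omit [Fintype μ] [DecidableEq ν] [DecidableEq μ] in
/-- [our object] Unfolding `defect`. -/
theorem defect_def (K B : Matrix ν ν 𝕜) (W : Matrix ν ρ 𝕜) :
    defect K B W = B - (K + B) * W * (Wᵀ * (K + B) * W)⁻¹ * Wᵀ * (K + B) := rfl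

omit [Fintype μ] [DecidableEq ν] [DecidableEq μ] in
/-- [folklore] `K + defect K B W` IS the deflated form of `K + B`. -/
theorem add_defect_eq_deflate (K B : Matrix ν ν 𝕜) (W : Matrix ν ρ 𝕜) :
    K + defect K B W = (K + B) - (K + B) * W * (Wᵀ * (K + B) * W)⁻¹ * Wᵀ * (K + B) := by
  rw [defect_def]; abel

/-- [folklore] **THE SLICE TRANSFER WITH DEFECT, IN THE ROAD'S LETTERS**: symmetric `K`, `B`; `Q·W = 0`; `Φ := Wᵀ(K+B)W` and `τW` with unit
determinants ⟹ `det kkt (K + B) Q · det(τW)² = (−1)^{|ρ|} · det Φ · det kkt (K + defect K B W) [Q; τ]`.  NO Ward letter, NO rank hypothesis. -/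
theorem det_kkt_transfer_defect {K B : Matrix ν ν 𝕜} (hK : Kᵀ = K) (hB : Bᵀ = B) (Q : Matrix μ ν 𝕜) (τ : Matrix ρ ν 𝕜) (W : Matrix ν ρ 𝕜)
    (hQW : Q * W = 0) (hΦ : IsUnit (Wᵀ * (K + B) * W).det) (hT : IsUnit (τ * W).det) :
    (kkt (K + B) Q).det * (τ * W).det ^ 2
      = (-1) ^ Fintype.card ρ * (Wᵀ * (K + B) * W).det * (kkt (K + defect K B W) (fromRows Q τ)).det := by
  have hY : (K + B)ᵀ = K + B := by rw [Matrix.transpose_add, hK, hB]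
  rw [add_defect_eq_deflate]
  exact det_kkt_transfer_deflate hY Q τ W hQW hΦ hT

omit [Fintype μ] [Fintype ρ] [DecidableEq ν] [DecidableEq μ] [DecidableEq ρ] in
/-- [folklore] Under the order-0 Ward relation `K·W = 0` the FP Gram of `K + B` is that of `B`: `Wᵀ(K+B)W = WᵀBW`. -/
theorem gram_add_of_ward {K : Matrix ν ν 𝕜} (B : Matrix ν ν 𝕜) (W : Matrix ν ρ 𝕜) (hKW : K * W = 0) :
    Wᵀ * (K + B) * W = Wᵀ * B * W := by
  rw [Matrix.mul_add, Matrix.add_mul, Matrix.mul_assoc Wᵀ K W, hKW, Matrix.mul_zero, zero_add]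

omit [Fintype μ] [DecidableEq ν] [DecidableEq μ] in
/-- [folklore] **THE DEFECT VANISHES UNDER THE WARD RELATION AND THE RANK IDENTITY**: `K·W = 0` and `B·W·(WᵀBW)⁻¹·Wᵀ·B = B` ⟹ `defect K B W = 0`
— so `det_kkt_transfer_defect` specialises to K-TA4G PART 1 `GramWeightDeterminant.det_kkt_add_rankWeight`. -/
theorem defect_eq_zero {K B : Matrix ν ν 𝕜} (hK : Kᵀ = K) (W : Matrix ν ρ 𝕜) (hKW : K * W = 0)
    (hrank : B * W * (Wᵀ * B * W)⁻¹ * Wᵀ * B = B) : defect K B W = 0 := by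
  have hWtK : Wᵀ * K = 0 := by
    have := congrArg Matrix.transpose hKW
    rwa [Matrix.transpose_mul, hK, Matrix.transpose_zero] at this
  have e1 : (K + B) * W = B * W := by rw [Matrix.add_mul, hKW, zero_add]
  have e2 : Wᵀ * (K + B) = Wᵀ * B := by rw [Matrix.mul_add, hWtK, zero_add]
  rw [defect_def, gram_add_of_ward B W hKW, e1, Matrix.mul_assoc (B * W * (Wᵀ * B * W)⁻¹) Wᵀ (K + B), e2, ← Matrix.mul_assoc, hrank,
    sub_self]

end Field

/-! ## §4 Over `ℝ`: the logarithmic form (input shape of the second-variation argument) -/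

section Real

variable {ν μ ρ : Type*} [Fintype ν] [Fintype μ] [Fintype ρ] [DecidableEq ν] [DecidableEq μ] [DecidableEq ρ]

/-- [folklore] **LOG FORM OF THE SLICE TRANSFER WITH DEFECT**: `log|det kkt (K+B) Q| + 2·log|det(τW)| = log|det Φ| + log|det kkt (K + D) [Q; τ]|`
(`D = defect K B W`, `Φ = Wᵀ(K+B)W`), for non-degenerate `τW`, `Φ`, `kkt (K+D) [Q;τ]` — and then `det kkt (K+B) Q ≠ 0`. -/
theorem log_absDet_transfer_defect {K B : Matrix ν ν ℝ} (hK : Kᵀ = K) (hB : Bᵀ = B) (Q : Matrix μ ν ℝ) (τ : Matrix ρ ν ℝ)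
    (W : Matrix ν ρ ℝ) (hQW : Q * W = 0) (hΦ : (Wᵀ * (K + B) * W).det ≠ 0) (hT : (τ * W).det ≠ 0)
    (hM : (kkt (K + defect K B W) (fromRows Q τ)).det ≠ 0) :
    (kkt (K + B) Q).det ≠ 0 ∧
      Real.log |(kkt (K + B) Q).det| + 2 * Real.log |(τ * W).det|
        = Real.log |(Wᵀ * (K + B) * W).det| + Real.log |(kkt (K + defect K B W) (fromRows Q τ)).det| :=
  log_form_of_abs_identity (abs_form_of_det_identity
    (det_kkt_transfer_defect hK hB Q τ W hQW (isUnit_iff_ne_zero.mpr hΦ) (isUnit_iff_ne_zero.mpr hT))) hT hΦ hM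

end Real

end Summit.QuantumFields.BalabanUV.Beta.D1BFx.SliceTransferDefect
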